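import Mathlib
import Summits.MatrixMultiplication.MatrixMultiplication.Theses.ThinBlockAlpha
import Summits.MatrixMultiplication.MatrixMultiplication.Theorems.ThinPackings.Negative.ThinPackingsStrengtheningsFalse

/-!
# BC2-redirect audit of the deciding crux `ThinBlockAlpha.ThinPackings` (stmt-MatrixMultiplication-10595)
# — kernel-checked decomposition attempts (crux-strategist r1, 2026-08-17)

Companion to `STRATEGY-CENSUS.md §Decomposition (r1)`.  The re-audit asks for a typed split
`X₁ ∧ … ∧ X_k → ThinPackings` with (a) k ≥ 2 load-bearing (open) pieces, (b) a PROVED and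
NON-TRIVIAL assembly, (c) no piece equivalent to `ThinPackings` (≡ `CThesis`, p76748) or to the
summit.  This file records, sorry-free, why the seams that can be typed TODAY fail:

* `ThinAt a η`       — the `(a, η)` slice of the crux; `ThinPackings ↔ ∀ a<1 ∀ η>0, ThinAt a η`
                       (`thinPackings_iff`, `Iff.rfl`) and the monotonicity `ThinAt.mono`.
* Attempt A (the route's own seam `BoundedThinPackings → ThinPackings`): a 3-line glue —
  fails (b) (trivial seam) and (a) (k = 1).                                  `seamA_bounded`
* Attempt B (regime seams in `a`): the high half ALONE gives the crux and is implied by it —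
  `ThinHigh ↔ ThinPackings`; the low half is idle.  Fails (a) and (c).   `seamB_*`
* Attempt C (iteration seam `BaseSlice ∧ ImprovementStep → ThinPackings`): the assembly IS
  non-trivial (induction on the iterate `a_k = 1 − 2^{-k}`, `η_k = 2^{-k}` + Archimedes,
  `seamC_thinPackings_of_step`, ~35 lines) and the base slice is a tree theorem
  (`thinPackings_at_zero`) — but the step is implied by the crux in ONE line
  (`seamC_step_of_thinPackings`), so `ImprovementStep ↔ ThinPackings`: fails (c) (and (a):
  one open piece).  Moral: an improvement step stated EXISTENTIALLY ("a better witness exists")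
  is the crux reworded; only a FUNCTORIAL step (the better witness built from the given one by
  a named operation) could be a piece — and tensor powers / symmetrisation preserve `(a, η)`
  exactly while block merging is impossible (census T8), so no such operation is known.
* Attempt F (dichotomy seams `(P → X) ∧ (¬P → X) → X`): assembly = `by_cases` (3 lines) —
  fails (b); both pieces are implied by the crux (`seamF_pieces_of`).      `seamF_*`
* Attempt D (tool + heart seams): the schema `compiler : Design → X`, `heart : Design` is modus
  ponens (`seamD_schema`); its six instances in the tree are listed in the census (compilers
  landed or L-sized tools ⇒ k_open = 1 ⇒ fails (a); relaxation hearts are ↔ crux ⇒ fail (c)).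

`lean check`: rc 0, 0 sorry.
-/

namespace Summit.MatrixMultiplication.MatrixMultiplication.Cruxes.ThinPackings.DecompositionAudit

open Literature.Computability.AlgebraicComplexity
open Summit.MatrixMultiplication.MatrixMultiplication.Theses.ThinBlockAlpha

/-! ## The slice and its monotonicity -/

/-- The `(a, η)` slice of the crux: a finite abelian `H` and an STPP family of `L` blocks
`⟨N, M, N⟩`, `N ≥ 2`, `N^a ≤ M`, `|H| ≤ L·N^{2+η}`. -/
def ThinAt (a η : ℝ) : Prop :=
  ∃ (H : Type) (_ : AddCommGroup H) (_ : Fintype H) (L N M : ℕ) (A B C : Fin L → Finset H),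
    IsSTPP A B C ∧ (∀ i, (A i).card = N ∧ (B i).card = M ∧ (C i).card = N) ∧ 2 ≤ N ∧
    (N : ℝ) ^ a ≤ M ∧ (Fintype.card H : ℝ) ≤ L * (N : ℝ) ^ (2 + η)

/-- The crux is literally the conjunction of its slices over `a ∈ [0,1)`, `η > 0`. -/
theorem thinPackings_iff :
    ThinPackings ↔ ∀ a : ℝ, 0 ≤ a → a < 1 → ∀ η : ℝ, 0 < η → ThinAt a η := Iff.rfl

/-- Slices are downward closed in `a` and upward closed in `η` (only `N ≥ 2 > 1` is used). -/
theorem ThinAt.mono {a a' η η' : ℝ} (h : ThinAt a' η') (ha : a ≤ a') (hη : η' ≤ η) :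
    ThinAt a η := by
  obtain ⟨H, i1, i2, L, N, M, A, B, C, hS, hc, hN, hM, hH⟩ := h
  have hN1 : (1 : ℝ) ≤ N := by exact_mod_cast (by omega : 1 ≤ N)
  refine ⟨H, i1, i2, L, N, M, A, B, C, hS, hc, hN, ?_, hH.trans ?_⟩
  · exact (Real.rpow_le_rpow_of_exponent_le hN1 ha).trans hM
  · exact mul_le_mul_of_nonneg_left (Real.rpow_le_rpow_of_exponent_le hN1 (by linarith))
      (Nat.cast_nonneg L)

/-! ## Attempt A — the route's own seam (`BoundedThinPackings`, stmt-14848) -/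

/-- Forgetting the exponent bound is a 3-line glue (= the landed `boundedToThin_proof`): the
seam `BoundedThinPackings → ThinPackings` is trivial (fails (b)) and has one piece (fails (a)). -/
theorem seamA_bounded (h : BoundedThinPackings) : ThinPackings := by
  intro a ha0 ha1 η hη
  obtain ⟨ℓ, hℓ⟩ := h a ha0 ha1
  obtain ⟨H, i1, i2, L, N, M, A, B, C, -, rest⟩ := hℓ η hη
  exact ⟨H, i1, i2, L, N, M, A, B, C, rest⟩

/-! ## Attempt B — regime seams in the shape exponent `a` -/

/-- The slices with `a ≥ 1/2`. -/
def ThinHigh : Prop := ∀ a : ℝ, 1 / 2 ≤ a → a < 1 → ∀ η : ℝ, 0 < η → ThinAt a η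

/-- The slices with `a < 1/2`. -/
def ThinLow : Prop := ∀ a : ℝ, 0 ≤ a → a < 1 / 2 → ∀ η : ℝ, 0 < η → ThinAt a η

/-- The high half alone gives the crux (monotonicity) — the low half is an idle premise. -/
theorem seamB_thinPackings_of_high (h : ThinHigh) : ThinPackings := by
  intro a ha0 ha1 η hη
  by_cases hle : 1 / 2 ≤ a
  · exact h a hle ha1 η hη
  · exact (h (1 / 2) le_rfl (by norm_num) η hη).mono (by linarith) le_rfl

/-- … and is implied by it: `ThinHigh ↔ ThinPackings` (fails (c)). -/
theorem seamB_high_of_thinPackings (h : ThinPackings) : ThinHigh :=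
  fun a ha ha1 η hη => h a (by linarith) ha1 η hη

theorem seamB_high_iff : ThinHigh ↔ ThinPackings :=
  ⟨seamB_thinPackings_of_high, seamB_high_of_thinPackings⟩

/-- The low half is a consequence, never used toward the crux. -/
theorem seamB_low_of_thinPackings (h : ThinPackings) : ThinLow :=
  fun a ha0 ha1 η hη => h a ha0 (by linarith) η hη

/-! ## Attempt C — iteration seam (base slice + existential improvement step) -/

/-- Improvement step, EXISTENTIAL form: a witness at `(a, η)` yields SOME witness at
`((1+a)/2, η/2)` (halve the distance to the corner `(1, 0)`). -/
def ImprovementStep : Prop :=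
  ∀ a η : ℝ, 0 ≤ a → a < 1 → 0 < η → ThinAt a η → ThinAt ((1 + a) / 2) (η / 2)

/-- Base slice `a = 0` (all `η > 0`) — a tree theorem (`thinPackings_at_zero`: one coset block
`⟨2,1,2⟩` in `(ℤ/2)²`). -/
def BaseSlice : Prop := ∀ η : ℝ, 0 < η → ThinAt 0 η

theorem baseSlice_holds : BaseSlice := fun η hη =>
  Summit.MatrixMultiplication.MatrixMultiplication.Theorems.ThinPackings.Negative.thinPackings_at_zero η hη

/-- The iterate `a_k = 1 − 2^{-k}`, `η_k = 2^{-k}`. -/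
theorem seamC_iterate (hB : BaseSlice) (hS : ImprovementStep) :
    ∀ k : ℕ, ThinAt (1 - (1 / 2 : ℝ) ^ k) ((1 / 2 : ℝ) ^ k) := by
  intro k
  induction k with
  | zero => simpa using hB 1 one_pos
  | succ k ih =>
    have hk0 : (0 : ℝ) < (1 / 2 : ℝ) ^ k := by positivity
    have hk1 : (1 / 2 : ℝ) ^ k ≤ 1 := pow_le_one₀ (by norm_num) (by norm_num)
    have h := hS (1 - (1 / 2 : ℝ) ^ k) ((1 / 2 : ℝ) ^ k) (by linarith) (by linarith) hk0 ih
    have e1 : (1 + (1 - (1 / 2 : ℝ) ^ k)) / 2 = 1 - (1 / 2 : ℝ) ^ (k + 1) := by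
      rw [pow_succ]; ring
    have e2 : (1 / 2 : ℝ) ^ k / 2 = (1 / 2 : ℝ) ^ (k + 1) := by
      rw [pow_succ]; ring
    rw [e1, e2] at h
    exact h

/-- ASSEMBLY of seam C (non-trivial: induction + Archimedes + monotonicity, ≈ 35 lines with
`seamC_iterate` and `ThinAt.mono`): base slice and improvement step give the crux. -/
theorem seamC_thinPackings_of_step (hB : BaseSlice) (hS : ImprovementStep) : ThinPackings := by
  intro a ha0 ha1 η hη
  obtain ⟨k, hk⟩ :=
    exists_pow_lt_of_lt_one (lt_min (sub_pos.mpr ha1) hη) (by norm_num : (1 / 2 : ℝ) < 1)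
  have hk1 : (1 / 2 : ℝ) ^ k < 1 - a := hk.trans_le (min_le_left _ _)
  have hk2 : (1 / 2 : ℝ) ^ k < η := hk.trans_le (min_le_right _ _)
  exact (seamC_iterate hB hS k).mono (by linarith) hk2.le

/-- … but the step is the crux reworded: ONE line from `ThinPackings` (fails (c)). -/
theorem seamC_step_of_thinPackings (h : ThinPackings) : ImprovementStep :=
  fun a η ha0 ha1 hη _ => h ((1 + a) / 2) (by linarith) (by linarith) (η / 2) (by linarith)

/-- Hence `ImprovementStep ↔ ThinPackings` outright (the base slice is a theorem). -/
theorem seamC_step_iff : ImprovementStep ↔ ThinPackings :=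
  ⟨seamC_thinPackings_of_step baseSlice_holds, seamC_step_of_thinPackings⟩

/-! ## Attempt F — dichotomy seams -/

/-- Assembly of any dichotomy split is a case split (trivial seam, fails (b)). -/
theorem seamF_assembly (P : Prop) (h₁ : P → ThinPackings) (h₂ : ¬ P → ThinPackings) :
    ThinPackings := by
  by_cases hP : P
  · exact h₁ hP
  · exact h₂ hP

/-- … and both branch pieces are consequences of the crux. -/
theorem seamF_pieces_of (P : Prop) (h : ThinPackings) :
    (P → ThinPackings) ∧ (¬ P → ThinPackings) := ⟨fun _ => h, fun _ => h⟩

/-! ## Attempt D — tool + heart seams (schema) -/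

/-- The schema of every registered line on this crux: a compiler `Design → ThinPackings` (landed
or an L-sized tool) and a design heart.  The seam is modus ponens; once the compiler lands the
split has ONE open piece, the heart, which is stronger than the crux (fails (a)). -/
theorem seamD_schema {Design : Prop} (compiler : Design → ThinPackings) (heart : Design) :
    ThinPackings := compiler heart

end Summit.MatrixMultiplication.MatrixMultiplication.Cruxes.ThinPackings.DecompositionAudit
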